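import Mathlib
import HarnessLib
import Summits.Ventures.LatticeQCDFlow.Exactness.IMHMultiProposalEquilibriumRenewal

/-!
# More proposals never hurt renewal: at equilibrium the multi-proposal (ensemble) flow sampler's probability of keeping the current
# configuration is NON-INCREASING in the batch size, for every flow

HONEST FRAMING: exact (Metropolis-corrected) sampling algorithms for lattice gauge theory;
figures of merit are autocorrelation/cost numbers at stated couplings and volumes; no
continuum-physics claim.

Venture `LatticeQCDFlow` (cell pub-lqcd), topic `Exactness`; FANOUT row 30 (lean-1, GEN-42).  NEW WORK of the cell, sequel of this generation's
`IMHMultiProposalEquilibriumRenewal` (the stay probability with `n = m + 1` fresh proposals is `r_m = (1 + n·D_m)/(n + 1)`,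
`D_m = ½∫ (w(z₀) − w(z₁))²/Σ_{i ≤ n} w(z_i) dq^{⊗(n+1)}`), over Mathlib (marginalising the last coordinate of a product law:
`measurePreserving_piFinSuccAbove` at `Fin.last`, `measurePreserving_snd`).

## Results (no `sorry`, no new definitions)
* `measurePreserving_init`, `integral_comp_init_eq` — `∫ F(init z) dq^{⊗(m+3)}(z) = ∫ F dq^{⊗(m+2)}`: an integrand blind to the last draw
  integrates it out (`measurePreserving_piFinSuccAbove` at `Fin.last`, then `measurePreserving_snd`).
* **`mismatch_succ_le`** — `Δ_{m+1} ≤ Δ_m`: adding a proposal to the pool can only increase the pool weight in the denominator of the mismatch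
  functional.
* `poolStay_le_one`, `mismatch_half_le_one` — `r_m ≤ 1`, hence `D_m ≤ 1`.
* **`poolStay_succ_le`** — `r_{m+1} ≤ r_m`: THE EQUILIBRIUM STAY PROBABILITY IS NON-INCREASING IN THE BATCH SIZE (from the two facts above and
  the identity of `IMHMultiProposalEquilibriumRenewal`: `(m + 2)(1 + (m + 2)D) ≤ (m + 3)(1 + (m + 1)D)` iff `D ≤ 1`);
  **`poolMove_succ_ge`** — equivalently the renewal probability `Σ_{j ≥ 1} s_j = 1 − r_m` is NON-DECREASING.
Reading (gauge files): at equilibrium, enlarging the batch of flow proposals per update of the ensemble gauge sampler never lowers the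
probability of moving to a fresh configuration — whatever the flow; by `IMHMultiProposalStickingFloor` it also never lowers the total number of
proposals an escape from a heavy configuration costs.  NOT CLAIMED: strict monotonicity; any statement away from equilibrium; the size of the
gain (`D_m − D_{m+1}` is not bounded here).
-/

noncomputable section

namespace Summit.Ventures.LatticeQCDFlow.Exactness

open MeasureTheory ProbabilityTheory Function Finset
open scoped ENNReal

variable {Ω : Type*} [MeasurableSpace Ω] {q : Measure Ω} [IsProbabilityMeasure q] {w : Ω → ℝ} {m : ℕ}

/-- Dropping the last draw is measure preserving: `q^{⊗(m+3)} ∘ init⁻¹ = q^{⊗(m+2)}`. [ours, bookkeeping] -/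
theorem measurePreserving_init (q : Measure Ω) [IsProbabilityMeasure q] (m : ℕ) :
    MeasurePreserving (fun z : Fin (m + 3) → Ω => Fin.init z) (Measure.pi fun _ : Fin (m + 3) => q) (Measure.pi fun _ : Fin (m + 2) => q) := by
  set e := MeasurableEquiv.piFinSuccAbove (fun _ : Fin (m + 3) => Ω) (Fin.last (m + 2)) with he
  have hmp : MeasurePreserving (fun z : Fin (m + 3) → Ω => (e z).2) (Measure.pi fun _ : Fin (m + 3) => q) (Measure.pi fun _ : Fin (m + 2) => q) :=
    (measurePreserving_snd (μ := q) (ν := Measure.pi fun _ : Fin (m + 2) => q)).comp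
      (measurePreserving_piFinSuccAbove (fun _ : Fin (m + 3) => q) (Fin.last (m + 2)))
  have hg : (fun z : Fin (m + 3) → Ω => Fin.init z) = fun z => (e z).2 := by
    funext z
    simp [he, MeasurableEquiv.piFinSuccAbove_apply]
  rw [hg]
  exact hmp

/-- **Integrating out the last draw**: for `F` a function of the first `m + 2` coordinates, `∫ F(init z) dq^{⊗(m+3)}(z) = ∫ F dq^{⊗(m+2)}`.
[ours, bookkeeping] -/
theorem integral_comp_init_eq (F : (Fin (m + 2) → Ω) → ℝ) (hF : AEStronglyMeasurable F (Measure.pi fun _ : Fin (m + 2) => q)) :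
    ∫ z, F (Fin.init z) ∂(Measure.pi fun _ : Fin (m + 3) => q) = ∫ y, F y ∂(Measure.pi fun _ : Fin (m + 2) => q) := by
  have hmp := measurePreserving_init q m
  calc ∫ z, F (Fin.init z) ∂(Measure.pi fun _ : Fin (m + 3) => q)
      = ∫ y, F y ∂((Measure.pi fun _ : Fin (m + 3) => q).map fun z => Fin.init z) :=
        (integral_map hmp.measurable.aemeasurable (by rw [hmp.map_eq]; exact hF)).symm
    _ = ∫ y, F y ∂(Measure.pi fun _ : Fin (m + 2) => q) := by rw [hmp.map_eq]

/-- **`Δ_{m+1} ≤ Δ_m`**: the mismatch functional is non-increasing in the pool size. [ours] -/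
theorem mismatch_succ_le (hw : Measurable w) (hw0 : ∀ y, 0 < w y) (hwi : Integrable w q) :
    ∫ z, (w (z 0) - w (z 1)) ^ 2 / ∑ i, w (z i) ∂(Measure.pi fun _ : Fin (m + 3) => q) ≤
      ∫ y, (w (y 0) - w (y 1)) ^ 2 / ∑ i, w (y i) ∂(Measure.pi fun _ : Fin (m + 2) => q) := by
  set F : (Fin (m + 2) → Ω) → ℝ := fun y => (w (y 0) - w (y 1)) ^ 2 / ∑ i, w (y i) with hF
  have hFi : Integrable F (Measure.pi fun _ : Fin (m + 2) => q) := integrable_sqDiff_div_poolWeight hw hw0 hwi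
  rw [← integral_comp_init_eq F hFi.aestronglyMeasurable]
  have hFi' : Integrable (fun z : Fin (m + 3) → Ω => F (Fin.init z)) (Measure.pi fun _ : Fin (m + 3) => q) :=
    ((measurePreserving_init q m).integrable_comp hFi.aestronglyMeasurable).2 hFi
  refine integral_mono (integrable_sqDiff_div_poolWeight (m := m + 1) hw hw0 hwi) hFi' fun z => ?_
  -- pointwise: same numerator, the longer pool has the larger weight
  have h0 : Fin.init z 0 = z 0 := rfl
  have h1 : Fin.init z 1 = z 1 := rfl
  simp only [hF, h0, h1]
  refine div_le_div_of_nonneg_left (sq_nonneg _) (poolWeight_pos hw0 _) ?_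
  rw [Fin.sum_univ_castSucc (f := fun i : Fin (m + 3) => w (z i))]
  exact le_add_of_nonneg_right (hw0 _).le

/-- `r_m ≤ 1`: the stay probability is a probability. [ours, bookkeeping] -/
theorem poolStay_le_one (hw : Measurable w) (hw0 : ∀ y, 0 < w y) (h1 : ∫ y, w y ∂q = 1) :
    ∫ z, w (z 0) * (w (z 0) / ∑ i, w (z i)) ∂(Measure.pi fun _ : Fin (m + 2) => q) ≤ 1 := by
  have hsum := poolSelect_sum_eq_one (m := m) hw hw0 h1
  rw [Fin.sum_univ_succ] at hsum
  have hwi : Integrable w q := by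
    by_contra h; rw [integral_undef h] at h1; exact zero_ne_one h1
  have hs : 0 ≤ ∑ i : Fin (m + 1), ∫ z, w (z 0) * (w (z i.succ) / ∑ k, w (z k)) ∂(Measure.pi fun _ : Fin (m + 2) => q) :=
    sum_nonneg fun i _ => integral_nonneg fun z => mul_nonneg (hw0 _).le (div_nonneg (hw0 _).le (poolWeight_pos hw0 z).le)
  linarith

/-- `D_m = Δ_m/2 ≤ 1`. [ours, bookkeeping] -/
theorem mismatch_half_le_one (hw : Measurable w) (hw0 : ∀ y, 0 < w y) (h1 : ∫ y, w y ∂q = 1) :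
    (∫ z, (w (z 0) - w (z 1)) ^ 2 / ∑ i, w (z i) ∂(Measure.pi fun _ : Fin (m + 2) => q)) / 2 ≤ 1 := by
  have hr := poolStay_le_one (m := m) hw hw0 h1
  rw [poolStay_eq hw hw0 h1] at hr
  have hm : (0 : ℝ) < m + 2 := by positivity
  rw [div_le_one hm] at hr
  have hD := mismatch_nonneg (q := q) (m := m) hw0
  nlinarith

/-- **THE STAY PROBABILITY IS NON-INCREASING IN THE BATCH SIZE: `r_{m+1} ≤ r_m`.** [ours] -/
theorem poolStay_succ_le (hw : Measurable w) (hw0 : ∀ y, 0 < w y) (h1 : ∫ y, w y ∂q = 1) :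
    ∫ z, w (z 0) * (w (z 0) / ∑ i, w (z i)) ∂(Measure.pi fun _ : Fin (m + 3) => q) ≤
      ∫ z, w (z 0) * (w (z 0) / ∑ i, w (z i)) ∂(Measure.pi fun _ : Fin (m + 2) => q) := by
  have hwi : Integrable w q := by
    by_contra h; rw [integral_undef h] at h1; exact zero_ne_one h1
  rw [poolStay_eq (m := m + 1) hw hw0 h1, poolStay_eq (m := m) hw hw0 h1]
  set Δ' := ∫ z, (w (z 0) - w (z 1)) ^ 2 / ∑ i, w (z i) ∂(Measure.pi fun _ : Fin (m + 3) => q)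
  set Δ := ∫ z, (w (z 0) - w (z 1)) ^ 2 / ∑ i, w (z i) ∂(Measure.pi fun _ : Fin (m + 2) => q)
  have hle : Δ' ≤ Δ := mismatch_succ_le hw hw0 hwi
  have hD1 : Δ / 2 ≤ 1 := mismatch_half_le_one hw hw0 h1
  have hD0 : 0 ≤ Δ' := mismatch_nonneg (q := q) (m := m + 1) hw0
  have hm : (0 : ℝ) < m + 2 := by positivity
  push_cast
  rw [div_le_div_iff₀ (by positivity) hm]
  have hm2 : (0 : ℝ) ≤ ((m : ℝ) + 2) ^ 2 := sq_nonneg _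
  nlinarith [mul_le_mul_of_nonneg_left hle hm2, hD1, hD0]

/-- **… EQUIVALENTLY THE RENEWAL PROBABILITY IS NON-DECREASING IN THE BATCH SIZE.** [ours] -/
theorem poolMove_succ_ge (hw : Measurable w) (hw0 : ∀ y, 0 < w y) (h1 : ∫ y, w y ∂q = 1) :
    ∑ j : Fin (m + 1), ∫ z, w (z 0) * (w (z j.succ) / ∑ i, w (z i)) ∂(Measure.pi fun _ : Fin (m + 2) => q) ≤
      ∑ j : Fin (m + 2), ∫ z, w (z 0) * (w (z j.succ) / ∑ i, w (z i)) ∂(Measure.pi fun _ : Fin (m + 3) => q) := by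
  have hs := poolSelect_sum_eq_one (m := m) hw hw0 h1
  have hs' := poolSelect_sum_eq_one (m := m + 1) hw hw0 h1
  rw [Fin.sum_univ_succ] at hs hs'
  have h := poolStay_succ_le (m := m) hw hw0 h1
  linarith

end Summit.Ventures.LatticeQCDFlow.Exactness
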